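import Summits.QuantumFields.YangMills.Theorems.ConvexGribovBodyNonSimplyConnectedLatticeGapStubInfluenceAntitone
import Literature.MathematicalPhysics.QuantumFieldTheory.LatticeGaugeShenZhuZhuProofs
import HarnessLib

/-!
# Sup-influence propagates inward: translation covariance of the Wilson specification
# (stub `stub_boxInfluence_inward` (INWARD) of crux stmt-QuantumFields-16405, route `ConvexGribovBody`, line `Sketch` v9)

For the lattice Yang–Mills (Wilson) specification `γ = ymSpecification ρ β` on `ℤ^d` and a lattice vector `v`,
write `θ_v = configShift v` (`(θ_v U)(y, i) = U(y − v, i)`) and `Λ + v = Λ.map (edgeShift v)`. The new piece of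
infrastructure of this file is **translation covariance** of the kernels,

  `∫ F dγ_{Λ+v}(· | θ_v η) = ∫ F ∘ θ_v dγ_Λ(· | η)`  (`integral_ymSpecification_shift`), equivalently
  `γ_Λ(· | η) ∘ θ_v⁻¹ = γ_{Λ+v}(· | θ_v η)`  (`ymSpecification_map_configShift`),

proved from the integral formula `integral_ymSpecification` (kernel means are ratios of product-Haar integrals over
the links of the volume): the product Haar measure is invariant under re-indexing the links along `edgeShift v`
(`MeasureTheory.measurePreserving_piCongrLeft`), gluing commutes with the shift, and the boundary Wilson action is
covariant,
`S_{Λ+v}(θ_v U) = S_Λ(U)` (`wilsonBoundaryAction_shift`, from `plaquettesTouching (Λ+v) = plaquettesTouching Λ + v`).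

The stub: if the `γ_{Λ_R}`-means of a local observable `A` vary by at most `δ(R)` over all exterior data (centred cubes
of links `Λ_R = [−R, R]⁴ × univ`), then for `‖x‖_∞ + R ≤ L` the `γ_{Λ_L}`-means of the translate `A ∘ θ_{−x}` ("`A` at
`x`") vary by at most `δ(R)`: the cube `Λ_R + x` lies in `Λ_L`, so by consistency (W `stub_influence_antitone`) it
suffices to bound the influence of the exterior of `Λ_R + x` on `A ∘ θ_{−x}`, which by translation covariance is the
influence of the exterior of `Λ_R` on `A`. (Georgii 2011, §5.1 (5.5)–(5.7): Gibbsian specifications of shift-invariant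
potentials are shift-invariant; Seiler LNP 159 Ch. 2.)
-/

set_option autoImplicit false

noncomputable section

open MeasureTheory
open Literature.Probability.LatticeModels hiding configShift configShift_apply
open Literature.MathematicalPhysics.QuantumLattice
open Literature.MathematicalPhysics.QuantumFieldTheory (isSpecification_ymSpecification_of_t2Space haarProbability)

namespace Summit.QuantumFields.YangMills.Theorems.NonSimplyConnectedLatticeGap

section ShiftGeometry

variable {d : ℕ} {G : Type*}

/-- Shifting by `-v` then by `v` is the identity: `θ_v (θ_{-v} U) = U`. -/
@[simp] theorem configShift_configShift_neg [MeasurableSpace G] (v : Site d) (U : LGConfig d G) :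
    configShift v (configShift (-v) U) = U := by
  funext e
  simp [Literature.MathematicalPhysics.QuantumLattice.configShift_apply]

/-- Shifting by `v` then by `-v` is the identity: `θ_{-v} (θ_v U) = U`. -/
@[simp] theorem configShift_neg_configShift [MeasurableSpace G] (v : Site d) (U : LGConfig d G) :
    configShift (-v) (configShift v U) = U := by
  funext e
  simp [Literature.MathematicalPhysics.QuantumLattice.configShift_apply]

/-- The edges of the translated plaquette are the translated edges. -/
theorem plaquetteEdges_shift (v y : Site d) (q : {q : Fin d × Fin d // q.1 < q.2}) :
    plaquetteEdges ((y + v, q) : ZdPlaquette d) = (plaquetteEdges ((y, q) : ZdPlaquette d)).map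
      (edgeShift v).toEmbedding := by
  simp only [plaquetteEdges, Finset.map_insert, Finset.map_singleton, Equiv.coe_toEmbedding, edgeShift_apply,
    add_right_comm _ v]

/-- Translation of plaquettes is injective. -/
theorem plaquette_shift_injective (v : Site d) :
    Function.Injective fun p : ZdPlaquette d => ((p.1 + v, p.2) : ZdPlaquette d) := by
  intro p q h
  simp only [Prod.mk.injEq, add_left_inj] at h
  exact Prod.ext h.1 h.2

/-- **The plaquettes touching a translated volume are the translated plaquettes**:
`plaquettesTouching (Λ + v) = plaquettesTouching Λ + v`. -/
theorem plaquettesTouching_map_edgeShift (v : Site d) (Λ : Finset (ZdEdge d)) :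
    plaquettesTouching (Λ.map (edgeShift v).toEmbedding) =
      (plaquettesTouching Λ).image fun p : ZdPlaquette d => ((p.1 + v, p.2) : ZdPlaquette d) := by
  ext p
  rw [Finset.mem_image, mem_plaquettesTouching_iff]
  constructor
  · intro h
    refine ⟨(p.1 - v, p.2), ?_, by simp⟩
    have hp : p = ((p.1 - v) + v, p.2) := by simp
    rw [hp, plaquetteEdges_shift, ← Finset.map_inter, Finset.map_nonempty] at h
    exact mem_plaquettesTouching_iff.2 h
  · rintro ⟨p₀, hp₀, rfl⟩
    rw [plaquetteEdges_shift, ← Finset.map_inter, Finset.map_nonempty]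
    exact mem_plaquettesTouching_iff.1 hp₀

variable [Group G] {N : ℕ} (ρ : G →* Matrix (Fin N) (Fin N) ℂ)

/-- The plaquette observable is translation covariant: the plaquette at `y + v` of `θ_v U` is the plaquette at
`y` of `U`. -/
theorem plaquetteObs_add_configShift [MeasurableSpace G] (v y : Site d) (i j : Fin d) (U : LGConfig d G) :
    plaquetteObs ρ (y + v) i j (configShift v U) = plaquetteObs ρ y i j U := by
  simp only [plaquetteObs, plaquetteHolonomyZd, Literature.MathematicalPhysics.QuantumLattice.configShift_apply,
    add_right_comm _ v, add_sub_cancel_right]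

/-- **Translation covariance of the boundary Wilson action**: `S_{Λ+v}(θ_v U) = S_Λ(U)`
(Seiler LNP 159 Ch. 2; Georgii 2011 (5.5)). -/
theorem wilsonBoundaryAction_shift [MeasurableSpace G] (v : Site d) (Λ : Finset (ZdEdge d)) (U : LGConfig d G) :
    wilsonBoundaryAction ρ (Λ.map (edgeShift v).toEmbedding) (configShift v U) = wilsonBoundaryAction ρ Λ U := by
  rw [wilsonBoundaryAction, wilsonBoundaryAction, plaquettesTouching_map_edgeShift,
    Finset.sum_image fun p _ q _ h => plaquette_shift_injective v h]
  exact Finset.sum_congr rfl fun p _ => by rw [plaquetteObs_add_configShift]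

end ShiftGeometry

section Covariance

variable {d N : ℕ} {G : Type*} [Group G] [TopologicalSpace G] [IsTopologicalGroup G] [CompactSpace G]
  [MeasurableSpace G] [BorelSpace G] [SecondCountableTopology G] (ρ : G →* Matrix (Fin N) (Fin N) ℂ)

/-- **Translation covariance of the lattice Yang–Mills specification (integral form).** For every finite link set
`Λ`, lattice vector `v`, boundary condition `η` and measurable `F`:
`∫ F dγ_{Λ+v}(· | θ_v η) = ∫ F ∘ θ_v dγ_Λ(· | η)`, where `Λ + v = Λ.map (edgeShift v)` and `θ_v = configShift v`.
Both sides are ratios of product-Haar integrals over the links (`integral_ymSpecification`); re-index the links of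
`Λ + v` along `e ↦ e + v` (the product Haar measure is preserved, `measurePreserving_piCongrLeft`), and use that gluing
commutes with the shift and `S_{Λ+v} ∘ θ_v = S_Λ` (Georgii 2011, §5.1, (5.5)–(5.7); Seiler LNP 159 Ch. 2). -/
theorem integral_ymSpecification_shift (hρ : Continuous ρ) (β : ℝ) (Λ : Finset (ZdEdge d)) (v : Site d)
    {F : LGConfig d G → ℝ} (hF : Measurable F) (η : LGConfig d G) :
    ∫ U, F U ∂(ymSpecification ρ β (Λ.map (edgeShift v).toEmbedding) (configShift v η)) =
      ∫ U, F (configShift v U) ∂(ymSpecification ρ β Λ η) := by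
  set Λ' := Λ.map (edgeShift v).toEmbedding with hΛ'
  -- re-index the links of `Λ` along the shift: `Λ ≃ Λ + v`, `e ↦ e + v`
  set eΛ : ↥Λ ≃ ↥Λ' := (edgeShift v).subtypeEquiv fun _ => (Finset.mem_map' (edgeShift v).toEmbedding).symm
  set Ψ : (↥Λ → G) ≃ᵐ (↥Λ' → G) := MeasurableEquiv.piCongrLeft (fun _ => G) eΛ
  have hΨm : MeasurePreserving Ψ.symm (Measure.pi fun _ : ↥Λ' => haarProbability G)
      (Measure.pi fun _ : ↥Λ => haarProbability G) :=
    (measurePreserving_piCongrLeft (fun _ : ↥Λ' => haarProbability G) eΛ).symm Ψ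
  -- gluing commutes with the shift: `θ_v (ζ∘(· + v) η_{Λᶜ}) = ζ (θ_v η)_{(Λ+v)ᶜ}`
  have hglue : ∀ ζ' : ↥Λ' → G, configShift v (glueWith Λ (Ψ.symm ζ') η) = glueWith Λ' ζ' (configShift v η) := by
    intro ζ'
    funext e'
    rw [Literature.MathematicalPhysics.QuantumLattice.configShift_apply]
    by_cases h' : e' ∈ Λ'
    · have h₀ : (e'.1 - v, e'.2) ∈ Λ := by
        rwa [hΛ', Finset.mem_map_equiv, edgeShift_symm_apply] at h'
      rw [glueWith_apply_mem _ _ _ h₀, glueWith_apply_mem _ _ _ h']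
      change ζ' (eΛ ⟨(e'.1 - v, e'.2), h₀⟩) = ζ' ⟨e', h'⟩
      congr 1
      exact Subtype.ext (Prod.ext (sub_add_cancel e'.1 v) rfl)
    · have h₀ : (e'.1 - v, e'.2) ∉ Λ := fun h => h' (by
        rw [hΛ', Finset.mem_map_equiv, edgeShift_symm_apply]; exact h)
      rw [glueWith_apply_not_mem _ _ _ h₀, glueWith_apply_not_mem _ _ _ h',
        Literature.MathematicalPhysics.QuantumLattice.configShift_apply]
  -- the boundary Wilson action is covariant
  have hS : ∀ ζ' : ↥Λ' → G, wilsonBoundaryAction ρ Λ (glueWith Λ (Ψ.symm ζ') η) =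
      wilsonBoundaryAction ρ Λ' (glueWith Λ' ζ' (configShift v η)) := fun ζ' => by
    rw [← hglue]
    exact (wilsonBoundaryAction_shift ρ v Λ _).symm
  rw [integral_ymSpecification ρ hρ β Λ' hF,
    integral_ymSpecification ρ hρ β Λ (F := fun U => F (configShift v U)) (hF.comp (configShift v).measurable),
    ← hΨm.integral_comp', ← hΨm.integral_comp']
  simp only [hglue, hS]

/-- **Translation covariance of the lattice Yang–Mills specification (push-forward form)**:
`γ_Λ(· | η) ∘ θ_v⁻¹ = γ_{Λ+v}(· | θ_v η)` (Georgii 2011, §5.1, (5.7); Seiler LNP 159 Ch. 2). -/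
theorem ymSpecification_map_configShift (hρ : Continuous ρ) (β : ℝ) (Λ : Finset (ZdEdge d)) (v : Site d)
    (η : LGConfig d G) :
    (ymSpecification ρ β Λ η).map (configShift v) =
      ymSpecification ρ β (Λ.map (edgeShift v).toEmbedding) (configShift v η) := by
  haveI := isProbabilityMeasure_ymSpecification ρ hρ β Λ η
  haveI := isProbabilityMeasure_ymSpecification ρ hρ β (Λ.map (edgeShift v).toEmbedding) (configShift v η)
  haveI : IsProbabilityMeasure ((ymSpecification ρ β Λ η).map (configShift v)) :=
    Measure.isProbabilityMeasure_map (configShift v).measurable.aemeasurable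
  ext A hA
  have hind : Measurable (A.indicator (1 : LGConfig d G → ℝ)) := measurable_one.indicator hA
  have h1 : ((ymSpecification ρ β Λ η).map (configShift v)).real A =
      (ymSpecification ρ β (Λ.map (edgeShift v).toEmbedding) (configShift v η)).real A := by
    rw [← integral_indicator_one hA, ← integral_indicator_one hA, integral_map_equiv,
      integral_ymSpecification_shift ρ hρ β Λ v hind η]
  rw [measureReal_def, measureReal_def, ENNReal.toReal_eq_toReal_iff' (measure_ne_top _ _)
    (measure_ne_top _ _)] at h1
  exact h1

end Covariance

/-- The translate of the centred cube of links of radius `R` by `x` lies in the centred cube of radius `L` when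
`|x_i| + R ≤ L` for all `i`. -/
theorem cube_map_edgeShift_subset {L R : ℕ} {x : Site 4} (hx : ∀ i : Fin 4, |x i| + (R : ℤ) ≤ (L : ℤ)) :
    ((Fintype.piFinset fun _ : Fin 4 => Finset.Icc (-((R : ℕ) : ℤ)) ((R : ℕ) : ℤ)) ×ˢ
        (Finset.univ : Finset (Fin 4))).map (edgeShift x).toEmbedding ⊆
      (Fintype.piFinset fun _ : Fin 4 => Finset.Icc (-((L : ℕ) : ℤ)) ((L : ℕ) : ℤ)) ×ˢ
        (Finset.univ : Finset (Fin 4)) := by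
  intro e he
  rw [Finset.mem_map_equiv, edgeShift_symm_apply, Finset.mem_product, Fintype.mem_piFinset] at he
  rw [Finset.mem_product, Fintype.mem_piFinset]
  refine ⟨fun k => ?_, Finset.mem_univ _⟩
  have hk := Finset.mem_Icc.1 (he.1 k)
  simp only [Pi.sub_apply] at hk
  have h1 := le_abs_self (x k)
  have h2 := neg_abs_le (x k)
  have h3 := hx k
  rw [Finset.mem_Icc]
  constructor <;> linarith [hk.1, hk.2]

/-- **Sup-influence propagates inward** (registered stub `stub_boxInfluence_inward` (INWARD) of the skeleton
`Cruxes/NonSimplyConnectedLatticeGap/Lines/Sketch.lean` v9 of item stmt-QuantumFields-16405). If the `γ_{Λ_R}`-means of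
the local observable `A` vary by at most `δ(R)` over all exterior data, then for every cube `Λ_L` and every `x` with
`|x_i| + R ≤ L` the `γ_{Λ_L}`-means of the translate `U ↦ A(θ_{−x} U)` vary by at most `δ(R)`: the translated cube
`Λ_R + x` lies in `Λ_L` (`cube_map_edgeShift_subset`), so by consistency (`stub_influence_antitone`, W) it suffices to
bound the influence of the exterior of `Λ_R + x` on `A ∘ θ_{−x}`, and by translation covariance
(`integral_ymSpecification_shift`) `γ_{Λ_R + x}(A ∘ θ_{−x} | ξ) = γ_{Λ_R}(A | θ_{−x} ξ)` (Georgii 2011, §5.1). -/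
theorem stub_boxInfluence_inward : ∀ (G : Type) [Group G] [TopologicalSpace G] [IsTopologicalGroup G] [CompactSpace G] [MeasurableSpace G] [BorelSpace G] [SecondCountableTopology G] [T2Space G] (N : ℕ) (ρ : G →* Matrix (Fin N) (Fin N) ℂ), Continuous ρ → ∀ (β : ℝ) (A : Literature.MathematicalPhysics.QuantumLattice.LocalGaugeObservable 4 G) (δ : ℕ → ℝ), (∀ (R : ℕ) (ζ ζ' : Literature.MathematicalPhysics.QuantumLattice.LGConfig 4 G), |(∫ U, A.F U ∂(Literature.MathematicalPhysics.QuantumLattice.ymSpecification ρ β ((Fintype.piFinset fun _ : Fin 4 => Finset.Icc (-((R : ℕ) : ℤ)) ((R : ℕ) : ℤ)) ×ˢ (Finset.univ : Finset (Fin 4))) ζ)) - ∫ U, A.F U ∂(Literature.MathematicalPhysics.QuantumLattice.ymSpecification ρ β ((Fintype.piFinset fun _ : Fin 4 => Finset.Icc (-((R : ℕ) : ℤ)) ((R : ℕ) : ℤ)) ×ˢ (Finset.univ : Finset (Fin 4))) ζ')| ≤ δ R) → ∀ (L R : ℕ) (x : Literature.Probability.LatticeModels.Site 4), (∀ i : Fin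 4, |x i| + (R : ℤ) ≤ (L : ℤ)) → ∀ (η η' : Literature.MathematicalPhysics.QuantumLattice.LGConfig 4 G), |(∫ U, A.F (Literature.MathematicalPhysics.QuantumLattice.configShift (-x) U) ∂(Literature.MathematicalPhysics.QuantumLattice.ymSpecification ρ β ((Fintype.piFinset fun _ : Fin 4 => Finset.Icc (-((L : ℕ) : ℤ)) ((L : ℕ) : ℤ)) ×ˢ (Finset.univ : Finset (Fin 4))) η)) - ∫ U, A.F (Literature.MathematicalPhysics.QuantumLattice.configShift (-x) U) ∂(Literature.MathematicalPhysics.QuantumLattice.ymSpecification ρ β ((Fintype.piFinset fun _ : Fin 4 => Finset.Icc (-((L : ℕ) : ℤ)) ((L : ℕ) : ℤ)) ×ˢ (Finset.univ : Finset (Fin 4))) η')| ≤ δ R := by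
  intro G _ _ _ _ _ _ _ _ N ρ hρ β A δ hδ L R x hx η η'
  obtain ⟨CA, hCA⟩ := A.bounded
  have hγ := isSpecification_ymSpecification_of_t2Space (d := 4) ρ hρ β
  set cube : ℕ → Finset (ZdEdge 4) := fun R =>
    (Fintype.piFinset fun _ : Fin 4 => Finset.Icc (-((R : ℕ) : ℤ)) ((R : ℕ) : ℤ)) ×ˢ (Finset.univ : Finset (Fin 4))
    with hcube
  have hfm : Measurable fun U : LGConfig 4 G => A.F (configShift (-x) U) :=
    A.measurable.comp (configShift (-x)).measurable
  -- translation covariance: the influence on `A ∘ θ_{-x}` of the exterior of `Λ_R + x` is that on `A` of `Λ_R`'s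
  have key : ∀ ξ : LGConfig 4 G,
      ∫ U, A.F (configShift (-x) U) ∂(ymSpecification ρ β ((cube R).map (edgeShift x).toEmbedding) ξ) =
        ∫ U, A.F U ∂(ymSpecification ρ β (cube R) (configShift (-x) ξ)) := by
    intro ξ
    have h := integral_ymSpecification_shift ρ hρ β (cube R) x hfm (configShift (-x) ξ)
    simpa only [configShift_configShift_neg, configShift_neg_configShift] using h
  -- consistency: the influence of `Λ_L`'s exterior is at most that of the exterior of `Λ_R + x ⊆ Λ_L`
  refine stub_influence_antitone (ZdEdge 4) G (ymSpecification ρ β) hγ ((cube R).map (edgeShift x).toEmbedding)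
    (cube L) (cube_map_edgeShift_subset hx) (fun U => A.F (configShift (-x) U)) hfm CA (fun U => hCA _) (δ R)
    (fun ξ ξ' => ?_) η η'
  rw [key ξ, key ξ']
  exact hδ R _ _

end Summit.QuantumFields.YangMills.Theorems.NonSimplyConnectedLatticeGap

end
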